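import Literature.AnabelianGeometry.SemiGraphs.BTempQDPairQuotientFunctor
import HarnessLib

/-!
# Semi-graphs of anabelioids, Appendix, proof of Theorem A.4: the reduced Hom-sets
# `Hom̄((B, Γ_B), (C, Γ_C)) = Hom_D((B, Γ_B), (C, Γ_C))/Γ_C` and their injection into `Hom_T(B/Γ_B, C/Γ_C)`

Mochizuki, *Semi-graphs of anabelioids*, Publ. RIMS **42** (2006) 221–322, Appendix, proof of
Theorem A.4, author's manuscript p. 83 l. −10 – p. 84 l. 3 [cite: MochizukiSemiAnbd2006, Thm A.4 proof pp.83-84]: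
"to reconstruct `T_i` from `D_i`, it suffices to reconstruct the morphisms `B/Γ_B → C/Γ_C` in `T_i`
between the images via `q_i` of two objects `(B, Γ_B)`, `(C, Γ_C)` of `D_i`. To this end, we define
`Hom̄((B, Γ_B), (C, Γ_C)) := Hom_{D_i}((B, Γ_B), (C, Γ_C))/Γ_C` [i.e., where `Γ_C` acts by composition
from the right], so that the functor `q_i` induces a natural map
`Hom̄((B, Γ_B), (C, Γ_C)) → Hom_{T_i}(B/Γ_B, C/Γ_C)` … Next, suppose that `(B, Γ_B)`, `(C, Γ_C)` are
strongly connected QD-pairs. Then observe that the functor `q_i` induces an injection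
`Hom̄((B, Γ_B), (C, Γ_C)) ↪ Hom_{T_i}(B/Γ_B, C/Γ_C)`. Indeed, this follows immediately by considering
the natural splitting [in `Q_i` or `T_i`] of `C ×_{C/Γ_C} C` into a coproduct of copies of `C` indexed
by `Γ_C` [together with the fact that `(B, Γ_B)`, `(C, Γ_C)` are strongly connected QD-pairs]."

Row **A4-H** of the abc-iut cell's `plan/L3/SUBDAG-SemiAnbd-Cor311.md` (sub-DAG holder seat
abc-iut-w5-d129; this file by wave-4 seat abc-iut-w4-d081, assigned by abc-iut-L3-lead ruling η3,
2026-08-26T00:31:21Z), over seat abc-iut-L3-t2's `QDPair` vocabulary (`QuasiTemperoidsQDPairs.lean`)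
and seat abc-iut-w5-d129's orbit-space quotients `q_i` for the model temperoid `T = B^temp(Π)`
(`BTempQDPairQuotients.lean`, `BTempQDPairQuotientFunctor.lean`):

* in ANY category: `QDPair.homBarSetoid P₁ P₂` — the relation "`f' = f ≫ γ` for some `γ ∈ Γ_{P₂}`"
  on morphisms of QD-pairs (`Γ_C` "acts by composition from the right"; it is an equivalence
  relation because `Γ_C` is a subgroup) — and the reduced Hom-set `QDPair.HomBar P₁ P₂`;
* in `B^temp(Π)`: `Γ_C`-related morphisms induce the SAME arrow `B/Γ_B → C/Γ_C`
  (`orbitQuotientMap_eq_of_homBarRel`), whence the printed natural map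
  `QDPair.homBarToHom : HomBar P₁ P₂ → (B/Γ_B ⟶ C/Γ_C)`;
* **the injection** `QDPair.homBarToHom_injective`: for `(B, Γ_B)` STRONGLY connected (`B`
  connected; `(C, Γ_C)` arbitrary — print assumes both strongly connected) two morphisms
  `f, f' : (B, Γ_B) → (C, Γ_C)` with `q(f) = q(f')` differ by an element of `Γ_C`
  (`exists_aut_of_orbitQuotientMap_eq`).  At the level of `Π`-sets the "natural splitting of
  `C ×_{C/Γ_C} C` into copies of `C` indexed by `Γ_C`" is the statement that the fibres of
  `C → C/Γ_C` are the `Γ_C`-orbits (`QDPair.orbitMk_eq_iff`): pick a point `b ∈ B`; `q(f) = q(f')`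
  gives `γ ∈ Γ_C` with `γ(f(b)) = f'(b)`, and two `Π`-maps out of the single `Π`-orbit `B` that agree
  at `b` coincide (`BTempConnected.hom_eq_of_apply_eq`).

Elementary `Π`-set theory for the tree's model of temperoids; nothing refers to the IUT corpus and
no side is taken on any disputed claim.
-/

open CategoryTheory

namespace Literature.AnabelianGeometry.SemiGraphs

open Literature.AlgebraicGeometry.Frobenioids (IsConnectedObj)
open Literature.AlgebraicGeometry.Frobenioids.QuasiTemperoid.BTempConnected (hom_eq_of_apply_eq
  nonempty_of_isConnectedObj)

universe v₁ u₁ u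

namespace QDPair

/-! ### `Hom̄ = Hom_D/Γ_C` in any category -/

section General

variable {Q : Type u₁} [Category.{v₁} Q]

/-- The relation "`Γ_C` acts [on `Hom_D((B, Γ_B), (C, Γ_C))`] by composition from the right":
`f ∼ f'` iff `f' = f ≫ γ` on underlying arrows for some `γ ∈ Γ_C` (an equivalence relation since
`Γ_C ⊆ Aut(C)` is a subgroup). [cite: MochizukiSemiAnbd2006, Thm A.4 proof p.83] -/
def homBarSetoid (P₁ P₂ : QDPair Q) : Setoid (P₁ ⟶ P₂) where
  r f f' := ∃ γ ∈ P₂.Γ, f'.hom = f.hom ≫ γ.hom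
  iseqv :=
    { refl := fun f => ⟨1, P₂.Γ.one_mem, by
        change f.hom = f.hom ≫ (Iso.refl _).hom
        rw [Iso.refl_hom, Category.comp_id]⟩
      symm := by
        rintro f f' ⟨γ, hγ, h⟩
        refine ⟨γ⁻¹, P₂.Γ.inv_mem hγ, ?_⟩
        change f.hom = f'.hom ≫ γ.inv
        rw [h, Category.assoc, γ.hom_inv_id, Category.comp_id]
      trans := by
        rintro f f' f'' ⟨γ, hγ, h⟩ ⟨δ, hδ, h'⟩
        refine ⟨δ * γ, P₂.Γ.mul_mem hδ hγ, ?_⟩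
        change f''.hom = f.hom ≫ (γ.hom ≫ δ.hom)
        rw [h', h, Category.assoc] }

/-- Unfolding the relation. [cite: MochizukiSemiAnbd2006, Thm A.4 proof p.83] -/
theorem homBarSetoid_rel_iff {P₁ P₂ : QDPair Q} (f f' : P₁ ⟶ P₂) :
    (homBarSetoid P₁ P₂).r f f' ↔ ∃ γ ∈ P₂.Γ, f'.hom = f.hom ≫ γ.hom :=
  Iff.rfl

/-- **`Hom̄((B, Γ_B), (C, Γ_C)) := Hom_D((B, Γ_B), (C, Γ_C))/Γ_C`** — the set of morphisms of QD-pairs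
modulo composition from the right with elements of `Γ_C`.
[cite: MochizukiSemiAnbd2006, Thm A.4 proof p.83] -/
def HomBar (P₁ P₂ : QDPair Q) : Type v₁ := Quotient (homBarSetoid P₁ P₂)

/-- The class of a morphism of QD-pairs in `Hom̄`. [cite: MochizukiSemiAnbd2006, Thm A.4 proof p.83] -/
def homBarMk {P₁ P₂ : QDPair Q} (f : P₁ ⟶ P₂) : HomBar P₁ P₂ := Quotient.mk (homBarSetoid P₁ P₂) f

/-- Every element of `Hom̄` is the class of a morphism. [cite: MochizukiSemiAnbd2006, Thm A.4 proof p.83] -/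
theorem homBarMk_surjective (P₁ P₂ : QDPair Q) : Function.Surjective (homBarMk (P₁ := P₁) (P₂ := P₂)) :=
  Quotient.mk_surjective

/-- Two morphisms have the same class in `Hom̄` iff they differ by an element of `Γ_C` on the right.
[cite: MochizukiSemiAnbd2006, Thm A.4 proof p.83] -/
theorem homBarMk_eq_iff {P₁ P₂ : QDPair Q} (f f' : P₁ ⟶ P₂) :
    homBarMk f = homBarMk f' ↔ ∃ γ ∈ P₂.Γ, f'.hom = f.hom ≫ γ.hom :=
  Quotient.eq (r := homBarSetoid P₁ P₂)

end General

/-! ### In `B^temp(Π)`: the natural map `Hom̄ → Hom_T(B/Γ_B, C/Γ_C)` and its injectivity -/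

section BTemp

variable {G : Type u} [Group G] [TopologicalSpace G] [IsTopologicalGroup G]

/-- `Γ_C`-related morphisms of QD-pairs of `B^temp(Π)` induce the same arrow `B/Γ_B → C/Γ_C`
(because `γ ≫ π_C = π_C` for `γ ∈ Γ_C`). [cite: MochizukiSemiAnbd2006, Thm A.4 proof p.83] -/
theorem orbitQuotientMap_eq_of_homBarRel {P₁ P₂ : QDPair (BTemp G)} {f f' : P₁ ⟶ P₂}
    (h : (homBarSetoid P₁ P₂).r f f') : orbitQuotientMap f = orbitQuotientMap f' := by
  obtain ⟨γ, hγ, hf'⟩ := h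
  apply P₁.orbitQuotient_hom_ext
  rw [orbitQuotientπ_map, orbitQuotientπ_map, hf', Category.assoc, P₂.aut_comp_orbitQuotientπ hγ]

/-- **The natural map `Hom̄((B, Γ_B), (C, Γ_C)) → Hom_T(B/Γ_B, C/Γ_C)` induced by `q`** (for
`T = B^temp(Π)`). [cite: MochizukiSemiAnbd2006, Thm A.4 proof p.83] -/
def homBarToHom (P₁ P₂ : QDPair (BTemp G)) :
    HomBar P₁ P₂ → (P₁.orbitQuotient ⟶ P₂.orbitQuotient) :=
  Quotient.lift (fun f => orbitQuotientMap f) fun _ _ h => orbitQuotientMap_eq_of_homBarRel h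

/-- The natural map on classes is `q`. [cite: MochizukiSemiAnbd2006, Thm A.4 proof p.83] -/
@[simp] theorem homBarToHom_mk {P₁ P₂ : QDPair (BTemp G)} (f : P₁ ⟶ P₂) :
    homBarToHom P₁ P₂ (homBarMk f) = orbitQuotientMap f := rfl

/-- **Key step of the injectivity** (print: "the natural splitting of `C ×_{C/Γ_C} C` into a
coproduct of copies of `C` indexed by `Γ_C`", read on points: the fibres of `C → C/Γ_C` are the
`Γ_C`-orbits): if `B` is connected and `q(f) = q(f')`, then `f' = f ≫ γ` for some `γ ∈ Γ_C`.
[cite: MochizukiSemiAnbd2006, Thm A.4 proof pp.83-84] -/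
theorem exists_aut_of_orbitQuotientMap_eq {P₁ P₂ : QDPair (BTemp G)} (h₁ : P₁.IsStronglyConnected)
    {f f' : P₁ ⟶ P₂} (h : orbitQuotientMap f = orbitQuotientMap f') :
    ∃ γ ∈ P₂.Γ, f'.hom = f.hom ≫ γ.hom := by
  obtain ⟨b⟩ := nonempty_of_isConnectedObj P₁.A h₁
  -- the classes of `f b` and `f' b` in `C/Γ_C` agree
  have hb : P₂.orbitMk (f.hom.hom.hom b) = P₂.orbitMk (f'.hom.hom.hom b) := by
    have := congrArg (fun χ : P₁.orbitQuotient ⟶ P₂.orbitQuotient =>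
      (χ.hom.hom (P₁.orbitMk b) : P₂.orbitQuotient.obj.V)) h
    simp only [orbitQuotientMap_apply] at this
    exact this
  -- hence `γ (f b) = f' b` for some `γ ∈ Γ_C`
  obtain ⟨γ, hγ, hγb⟩ := P₂.orbitMk_eq_iff.mp hb
  refine ⟨γ, hγ, ?_⟩
  -- two `Π`-maps out of the single orbit `B` agreeing at `b` coincide
  exact (hom_eq_of_apply_eq h₁ (f.hom ≫ γ.hom) f'.hom b hγb).symm

/-- For `B` connected: `q(f) = q(f')` iff `f`, `f'` have the same class in `Hom̄`.
[cite: MochizukiSemiAnbd2006, Thm A.4 proof pp.83-84] -/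
theorem orbitQuotientMap_eq_iff_homBarMk_eq {P₁ P₂ : QDPair (BTemp G)}
    (h₁ : P₁.IsStronglyConnected) (f f' : P₁ ⟶ P₂) :
    orbitQuotientMap f = orbitQuotientMap f' ↔ homBarMk f = homBarMk f' := by
  rw [homBarMk_eq_iff]
  exact ⟨exists_aut_of_orbitQuotientMap_eq h₁, fun h => orbitQuotientMap_eq_of_homBarRel h⟩

/-- **"The functor `q_i` induces an injection `Hom̄((B, Γ_B), (C, Γ_C)) ↪ Hom_{T_i}(B/Γ_B, C/Γ_C)`"**
for `(B, Γ_B)` strongly connected (here `T = B^temp(Π)`; `(C, Γ_C)` arbitrary).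
[cite: MochizukiSemiAnbd2006, Thm A.4 proof pp.83-84] -/
theorem homBarToHom_injective {P₁ : QDPair (BTemp G)} (P₂ : QDPair (BTemp G))
    (h₁ : P₁.IsStronglyConnected) : Function.Injective (homBarToHom P₁ P₂) := by
  intro a a' haa'
  induction a using Quotient.ind with
  | _ f =>
    induction a' using Quotient.ind with
    | _ f' =>
      exact Quotient.sound (exists_aut_of_orbitQuotientMap_eq h₁ haa')

end BTemp

end QDPair

end Literature.AnabelianGeometry.SemiGraphs
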